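import Summits.AtomisticToContinuum.HydrodynamicLimit.Theses.TwoClocks

/-!
# `TransferEntropyClock` (stmt-AtomisticToContinuum-16625): a refutation would refute the summit conjunct (negative helper file; no Theses declaration is asserted; see `Cruxes/TransferEntropyClock/Disproof.lean` §1; refuter-cdisprove-stmt-AtomisticToContinuum-16625-0)

The crux (route TwoClocks, rank 11; rev-10 restatement of `ClampedEntropyClock` stmt-15145 over the repaired
collisional pair) is the implication `KineticWindowLDUniform → ClampedTransferWindowLD → TransferActivityTails →
EnergyCurrentTails → DiluteSelfConsistency → HydrodynamicLimit` whose conclusion is the sub-problem Statement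
(the packing-guarded conjunct since the re-type D-0032). Two pure-logic facts, the kernel-checked reason the
standing disprover reports "no kill" on the crux ITSELF:

* `not_hydrodynamicLimit_of_not_transferEntropyClock` — any refutation of the crux is a refutation of the summit
  conjunct `HydrodynamicLimit`;
* `not_transferEntropyClock_iff` — exactly: `¬ TransferEntropyClock` holds iff the five open-problem-grade inputs
  hold AND `HydrodynamicLimit` fails.

Consequently the crux can only die through its parts (a refuted antecedent makes it VACUOUSLY TRUE — a prover's
ex-falso landing and a planner's restatement, not a refutation; that is how its predecessor stmt-15145 closed),
and its honest risk is provability from the antecedents as typed; see the companion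
`Negative/AllBetaKineticChildFalse.lean` for the refutation of the `∀ β` re-typing of its kinetic child.
-/

namespace Summit.AtomisticToContinuum.HydrodynamicLimit.Theorems

namespace TransferEntropyClockNegative

open Summit.AtomisticToContinuum.HydrodynamicLimit.Theses.TwoClocks

/-- **Any refutation of the crux `TransferEntropyClock` refutes the summit conjunct**: the crux is an
implication concluding `HydrodynamicLimit`, hence implied by it. [folklore] -/
theorem not_hydrodynamicLimit_of_not_transferEntropyClock (h : ¬ TransferEntropyClock) :
    ¬ _root_.HydrodynamicLimit := by
  intro hHL
  apply h
  unfold TransferEntropyClock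
  intro _ _ _ _ _
  exact hHL

/-- **The refutation problem for `TransferEntropyClock`, exactly**: its negation is equivalent to the
conjunction of its five antecedents (the docking node, the transfer-clamped collisional window LD, the two
a-priori tail inputs, dilute self-consistency — each open-problem grade) with the NEGATION of the summit
conjunct. [folklore] -/
theorem not_transferEntropyClock_iff :
    ¬ TransferEntropyClock ↔
      (KineticWindowLDUniform ∧ ClampedTransferWindowLD ∧ TransferActivityTails ∧
        EnergyCurrentTails ∧ DiluteSelfConsistency ∧ ¬ _root_.HydrodynamicLimit) := by
  unfold TransferEntropyClock
  constructor
  · intro h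
    by_contra hc
    apply h
    intro hK h₃ h₇ h₆ hS
    by_contra hHL
    exact hc ⟨hK, h₃, h₇, h₆, hS, hHL⟩
  · rintro ⟨hK, h₃, h₇, h₆, hS, hHL⟩ hC
    exact hHL (hC hK h₃ h₇ h₆ hS)

/-- **Load-bearing analysis is equally out of reach**: dropping any antecedent `H` gives a statement still
sandwiched between the summit conjunct and the crux, so a `transferEntropyClock_false_without_<H>` theorem is
exactly "the other four inputs hold and `HydrodynamicLimit` fails". Stated for `DiluteSelfConsistency` (the
PDE input a refuter is most tempted to drop); the other four are literally analogous. [folklore] -/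
theorem not_transferEntropyClock_withoutDSC_iff :
    ¬ (KineticWindowLDUniform → ClampedTransferWindowLD → TransferActivityTails → EnergyCurrentTails →
        _root_.HydrodynamicLimit) ↔
      (KineticWindowLDUniform ∧ ClampedTransferWindowLD ∧ TransferActivityTails ∧
        EnergyCurrentTails ∧ ¬ _root_.HydrodynamicLimit) := by
  constructor
  · intro h
    by_contra hc
    apply h
    intro hK h₃ h₇ h₆
    by_contra hHL
    exact hc ⟨hK, h₃, h₇, h₆, hHL⟩
  · rintro ⟨hK, h₃, h₇, h₆, hHL⟩ hC
    exact hHL (hC hK h₃ h₇ h₆)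

end TransferEntropyClockNegative

end Summit.AtomisticToContinuum.HydrodynamicLimit.Theorems
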